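import Summits.BirchSwinnertonDyer.BirchSwinnertonDyer.Theorems.Rank1ResidualX9Defs
import Summits.BirchSwinnertonDyer.Rank1Residual.X10.AnomalousCongruenceInvariant
import Summits.BirchSwinnertonDyer.Rank1Residual.Additive.PlusSymbolIntegrality
import Literature.NumberTheory.EllipticCurves.Rank1Residual.X9CMPartner
import Literature.NumberTheory.EllipticCurves.PAdicBSDInterpolationProofs
import Literature.NumberTheory.EllipticCurves.IwasawaLeadingTermProofs
import Literature.NumberTheory.EllipticCurves.ModPReducibilityProofs
import HarnessLib

/-!
# K6 crux `AnalyticMuZeroX9` (stmt-BirchSwinnertonDyer-19630), congruence-transfer road, lane B gen 2,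
# route-independent file: the ANOMALOUS X9 sub-class — anomalous is a congruence invariant, the
# unit-`L`-value display of gen 0 is vacuous there, and NO good-ordinary elliptic member of an anomalous
# congruence class has a unit constant coefficient or a unit cyclotomic special value (unconditional)

Cell `b2b-bsdres`, WIDTH-LEVER lane B (unit `b2b-bsdres-x9x`, gen 2; gen 0 = p527576,
`…AnalyticMuZeroX9UnitValuePartner.lean`). HONEST FRAMING: theorems only (no definition, no named fact,
nothing asserted about any curve); `--supports` helper of item 19630; nothing is booked; BSD is not
proved by any of this; the class-wide crux `Rank1Residual.AnalyticMuZeroOnClassX9` (:= the route decl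
`Theses.SmallImageMuTransfer.AnalyticMuZeroX9`) is Greenberg's `μ = 0` (LNM 1716 Conj. 1.11, analytic
side) on class X9 and stays OPEN. This file imports no route file (theses-cone hygiene); the companion
by-name display of the road (repaired: a unit coefficient at ANY index, and its equivalence with the crux) is the
print-tier seat's `…AnalyticMuZeroX9CertifiedPartner.lean` (landed first; not re-filed by this lane).

## What is proved (and what it says about the road)

Gen 0 displayed the crux BY NAME from the class-wide hypothesis «every X9 pair `(W, p)` has a
`p`-congruent globally minimal partner `A`, good ordinary and NON-ANOMALOUS at `p` (`p ∤ a_p(A) − 1`),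
with `L(A,1)/Ω_A` a `p`-adic unit» (`analyticMuZeroX9_of_forall_exists_unitLValuePartner`). That
hypothesis is not "open": it is FALSE as soon as ONE anomalous X9 pair exists (the cell's census of
record, `pub/bsd-smallim/k6fin/pkg/data/x9_790.json`, has 119 anomalous X9 pairs at `N < 5·10⁵` — 61 of
analytic rank `0`, 58 of rank `1`; e.g. `648c1 @ 5` with `a_5 = 1`, `129472do1 @ 5` with `a_5 = −4`), because

* §1 `dvd_frobeniusTrace_sub_one_iff_of_partner_of_classX9` — **anomalous is a congruence invariant
  on X9**: for an X9 pair `(W, p)` and any globally minimal `A` good ordinary at `p` with a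
  `Γ_ℚ`-equivariant `A[p] ≃ W[p]`, `p ∣ a_p(W) − 1 ↔ p ∣ a_p(A) − 1` (the x10 seat's
  `X10.dvd_frobeniusTrace_sub_one_iff_of_torsionIso`, Serre 1972 §1.11: an arithmetic Frobenius acts on
  `E[p]/ker(red)` by `a_p`, and the kernel of reduction is generated by the inertia coboundaries, so it
  is matched by any equivariant isomorphism);
* §2 `not_exists_nonAnomalousPartner_of_anomalous_classX9`,
  `not_forall_exists_unitLValuePartner_of_exists_anomalous_classX9` — hence an anomalous X9 pair has NO
  non-anomalous partner, and gen 0's displayed hypothesis fails (given one anomalous X9 pair, displayed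
  as an existential: class-X9 membership of a census curve is a finite check outside the kernel);
  CONCURRENT-WORK NOTE (doc-only, 2026-08-27): §1 and §2 were found independently and landed 34 minutes
  EARLIER by the print-tier seat `bsd-print-x9-p2` as
  `dvd_frobeniusTrace_sub_one_of_torsionIso_of_classX9` / `not_forall_exists_nonanomalousPartner_of_anomalous`
  (file `…AnalyticMuZeroX9CertifiedPartner.lean`, 13:12Z; this file 13:46Z) — the statements here are
  the `↔` form of their §1 and the `∃`-hypothesis form of their refutation, logically equivalent
  bookkeeping over the same x10 kernel theorem; cite THEIR declarations as the ones of record for §1/§2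
  (and their `analyticMuZeroX9_iff_forall_exists_certifiedPartner` for the repaired display and its
  equivalence with the crux, which this lane therefore does not re-file); the content proper to this
  file is §3, §3b and `unitCoeff_index_ne_zero_of_partner_of_anomalous_classX9`;
* §3 `norm_coeff_zero_padicLFunction_lt_one_of_anomalous` — **at an anomalous good ordinary odd prime
  with `A[p]` irreducible, the constant coefficient of `L_p(f, α_A)` is a NON-unit for every newform `f`
  of `A`** (indeed `‖c₀‖ ≤ ‖#Ã(𝔽_p)‖²_p ≤ p⁻²`): `c₀ = (1 − α⁻¹)²·[0]⁺_f` (Mazur–Swinnerton-Dyer, tree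
  theorem `constantCoeff_padicLFunction_unitRoot`), `1 − α⁻¹ = u·#Ã(𝔽_p)` (tree
  `exists_unit_one_sub_unitRoot_inv`), `p ∣ #Ã(𝔽_p)` (anomalous), and `‖[0]⁺_f‖_p ≤ 1` (Drinfeld–Manin
  made `p`-integral under (irr), tree `Additive.norm_ratPlusSymbol_le_one_of_irreducible`, n1011-p09);
  with §1, every good-ordinary elliptic member of the congruence class of an anomalous X9 pair has a
  non-unit constant coefficient (`norm_coeff_zero_lt_one_of_partner_of_anomalous_classX9`): the
  unit-SPECIAL-VALUE certificate — the only "known invariant" of a weight-two partner that is a closed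
  formula — never fires there, for ANY elliptic partner (`unitCoeff_index_ne_zero_of_partner_…`: a unit
  coefficient of a partner has positive index);
* §3b `norm_cyclotomicValue_padicLFunction_lt_one_of_anomalous` — nor is any CYCLOTOMIC special value a
  unit there: for every primitive even `p`-power-order `χ` of conductor `p^m`, `m ≥ 1`,
  `‖L_p(f, α_A)(χ(γ) − 1)‖_p = ‖α⁻ᵐ ∑_a χ(a)[a/p^m]⁺_f‖_p < 1` (`= α⁻ᵐ τ(χ) L(A, χ̄, 1)/Ω⁺_f`; the value
  is `∑ c_k (ζ − 1)^k` with `‖c₀‖ < 1`, `‖c_k‖ ≤ 1` — Greenberg–Vatsal Prop. 3.7, tree theorem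
  `padicLFunction_mem_integral_holds` — and `‖ζ − 1‖ < 1`, in the ultrametric `ℂ_p`); so the natural
  repair of gen 0's display by unit TWISTED `L`-values is void on the anomalous sub-class as well
  (`norm_cyclotomicValue_lt_one_of_partner_of_anomalous_classX9`); `μ^an = 0` is visible there only as
  valuations of these values tending to `0` up the tower, never as a unit.

All of §1–§3b is UNCONDITIONAL (no named fact as hypothesis). Consequence for the road: on the
anomalous sub-class a transfer certificate is a higher coefficient (exact modular symbols — lane A) or
an interior critical value of a weight-`k` member of `H(ρ̄)`, `k ≡ 2 (mod p − 1)`, `k ≥ 2p` (not in the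
tree's weight-two `padicLFunction` vocabulary; per `ρ̄` only in any case). The REPAIRED display (a unit
coefficient at any index) and its EQUIVALENCE with the crux are `analyticMuZeroX9_iff_forall_exists_certifiedPartner`
(`…AnalyticMuZeroX9CertifiedPartner.lean`, seat `bsd-print-x9-p2`).

References: J.-P. Serre, Invent. Math. 15 (1972) §1.11 [Serre1972]; B. Mazur, Invent. Math. 18 (1972)
§1 (anomalous primes) [Mazur1972]; B. Mazur, J. Tate, J. Teitelbaum, Invent. Math. 84 (1986) §I.14
(14.3) [MazurTateTeitelbaum1986Invent]; R. Greenberg, V. Vatsal, Invent. Math. 142 (2000) §3, Prop. 3.7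
[GreenbergVatsal2000]; M. Emerton, R. Pollack, T. Weston, Invent. Math. 163 (2006) Thm. 1
[EmertonPollackWeston2006]; R. Greenberg, LNM 1716 (1999) Conj. 1.11 [GreenbergLNM1716].
-/

-- the summit and its single problem are both named `BirchSwinnertonDyer` (registry layout D-0017)
set_option linter.dupNamespace false

set_option autoImplicit false

noncomputable section

open scoped Classical MatrixGroups ModularForm

open CongruenceSubgroup WeierstrassCurve Field
open Literature.NumberTheory.EllipticCurves Literature.NumberTheory.EllipticCurves.ModularForms
open Literature.NumberTheory.EllipticCurves.Rank1Residual (hasIrreducibleModPGaloisRep_of_torsionIso_symm)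

namespace Summit.BirchSwinnertonDyer.BirchSwinnertonDyer.Rank1Residual

/-! ### §1 Anomalous is a congruence invariant (X9 currency) -/

/-- **Anomalous is constant on the good-ordinary congruence class of an X9 pair.** For an X9 pair
`(W, p)` (`Rank1Residual.ClassX9`: non-CM, `p ≥ 5` good ordinary, `W[p]` irreducible, `ρ̄` not
surjective) and a globally minimal `A/ℚ` with good ordinary reduction at `p` and a `Γ_ℚ`-equivariant
additive isomorphism `A[p] ≃ W[p]`: `p ∣ a_p(W) − 1 ↔ p ∣ a_p(A) − 1`. This is the x10 seat's
`X10.dvd_frobeniusTrace_sub_one_iff_of_torsionIso` (any odd `p`) read at `p ≥ 5`.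
[cite: Serre1972, §1.11 (1), Prop. 11 and Cor.] [cite: Mazur1972, §1 (anomalous primes)] -/
theorem dvd_frobeniusTrace_sub_one_iff_of_partner_of_classX9
    (W : WeierstrassCurve ℚ) [W.IsElliptic] [W.IsGloballyMinimal] (p : ℕ) [Fact p.Prime]
    (hX9 : ClassX9 W p)
    (A : WeierstrassCurve ℚ) [A.IsElliptic] [A.IsGloballyMinimal]
    (hgoodA : A.HasGoodReductionAtPrime p) (hordA : ¬ (p : ℤ) ∣ A.frobeniusTrace p)
    (hiso : ∃ e : geomTorsion A (p : ℤ) ≃+ geomTorsion W (p : ℤ),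
      ∀ (σ : Field.absoluteGaloisGroup ℚ) (P : geomTorsion A (p : ℤ)), e (σ • P) = σ • e P) :
    (p : ℤ) ∣ W.frobeniusTrace p - 1 ↔ (p : ℤ) ∣ A.frobeniusTrace p - 1 := by
  obtain ⟨-, hp, hgood, hord, -, -⟩ := hX9
  have hp2 : p ≠ 2 := by omega
  exact Summit.BirchSwinnertonDyer.Rank1Residual.X10.dvd_frobeniusTrace_sub_one_iff_of_torsionIso
    hp2 hgood hord hgoodA hordA hiso

/-! ### §2 NEGATIVE: an anomalous X9 pair has no non-anomalous partner; gen 0's display is vacuous there -/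

/-- **No non-anomalous partner for an anomalous X9 pair.** If `(W, p)` is an X9 pair with
`p ∣ a_p(W) − 1`, there is NO globally minimal `A/ℚ`, good ordinary at `p`, with a `Γ_ℚ`-equivariant
`A[p] ≃ W[p]` and `p ∤ a_p(A) − 1` — whatever else is asked of `A` (the trailing conjunct `R A` is
arbitrary: unit `L`-value, rank, conductor …). Unconditional. [cite: Serre1972, §1.11 (1), Prop. 11 and Cor.] -/
theorem not_exists_nonAnomalousPartner_of_anomalous_classX9
    (W : WeierstrassCurve ℚ) [W.IsElliptic] [W.IsGloballyMinimal] (p : ℕ) [Fact p.Prime]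
    (hX9 : ClassX9 W p) (hanom : (p : ℤ) ∣ W.frobeniusTrace p - 1)
    (R : ∀ (A : WeierstrassCurve ℚ) [A.IsElliptic] [A.IsGloballyMinimal], Prop) :
    ¬ ∃ (A : WeierstrassCurve ℚ) (_ : A.IsElliptic) (_ : A.IsGloballyMinimal),
        A.HasGoodReductionAtPrime p ∧ ¬ (p : ℤ) ∣ A.frobeniusTrace p ∧
        (∃ e : geomTorsion A (p : ℤ) ≃+ geomTorsion W (p : ℤ),
          ∀ (σ : Field.absoluteGaloisGroup ℚ) (P : geomTorsion A (p : ℤ)), e (σ • P) = σ • e P) ∧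
        ¬ (p : ℤ) ∣ A.frobeniusTrace p - 1 ∧ R A := by
  rintro ⟨A, _, _, hgoodA, hordA, hiso, hapA, -⟩
  exact hapA ((dvd_frobeniusTrace_sub_one_iff_of_partner_of_classX9 W p hX9 A hgoodA hordA hiso).mp
    hanom)

/-- **Gen 0's class-level display is vacuous on the anomalous sub-class.** The displayed hypothesis
`hpartner` of `analyticMuZeroX9_of_forall_exists_unitLValuePartner` (p527576) — «every X9 pair has a
good-ordinary, NON-ANOMALOUS `p`-congruent partner with unit `L`-value» — is FALSE as soon as one
anomalous X9 pair `(W₀, p₀)` exists (displayed existential `hex`; the cell's census of record lists 61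
anomalous rank-`0` and 58 anomalous rank-`1` X9 pairs at `N < 5·10⁵`, e.g. `648c1 @ 5`, `a_5 = 1`, whose class-X9 membership
is a finite check outside the kernel). So that display, as stated, is not the road's open content; the
repaired display is `analyticMuZeroX9_of_forall_exists_certifiedPartner` (`…CertifiedPartner.lean`, which also
carries this refutation as `not_forall_exists_nonanomalousPartner_of_anomalous`, landed first). Unconditional.
[cite: Serre1972, §1.11 (1), Prop. 11 and Cor.]
[cite: Mazur1972, §1 (anomalous primes)] -/
theorem not_forall_exists_unitLValuePartner_of_exists_anomalous_classX9
    (hex : ∃ (W₀ : WeierstrassCurve ℚ) (_ : W₀.IsElliptic) (_ : W₀.IsGloballyMinimal) (p₀ : ℕ)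
      (_ : Fact p₀.Prime), ClassX9 W₀ p₀ ∧ (p₀ : ℤ) ∣ W₀.frobeniusTrace p₀ - 1) :
    ¬ (∀ (W : WeierstrassCurve ℚ) [W.IsElliptic] [W.IsGloballyMinimal] (p : ℕ) [Fact p.Prime],
      ClassX9 W p →
      ∃ (A : WeierstrassCurve ℚ) (_ : A.IsElliptic) (_ : A.IsGloballyMinimal),
        A.HasGoodReductionAtPrime p ∧ ¬ (p : ℤ) ∣ A.frobeniusTrace p ∧
        (∃ e : geomTorsion A (p : ℤ) ≃+ geomTorsion W (p : ℤ),
          ∀ (σ : Field.absoluteGaloisGroup ℚ) (P : geomTorsion A (p : ℤ)), e (σ • P) = σ • e P) ∧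
        ¬ (p : ℤ) ∣ A.frobeniusTrace p - 1 ∧
        ∃ q : ℚ, q ≠ 0 ∧ A.entireLFunction 1 / (A.realPeriodRat : ℂ) = (q : ℂ) ∧
          padicValRat p q = 0) := by
  intro hpartner
  obtain ⟨W₀, _, _, p₀, _, hX9, hanom⟩ := hex
  exact not_exists_nonAnomalousPartner_of_anomalous_classX9 W₀ p₀ hX9 hanom
    (fun A _ _ => ∃ q : ℚ, q ≠ 0 ∧ A.entireLFunction 1 / (A.realPeriodRat : ℂ) = (q : ℂ) ∧
      padicValRat p₀ q = 0)
    (hpartner W₀ p₀ hX9)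

/-! ### §3 The unit-special-value certificate never fires at an anomalous prime (unconditional) -/

/-- **At an anomalous good ordinary odd prime with irreducible `A[p]`, the constant coefficient of
`L_p(f, α_A)` is not a unit**, for every newform `f` of `A` (any level): indeed
`‖[T⁰]L_p(f, α_A)‖_p ≤ ‖#Ã(𝔽_p)‖_p² < 1`. Proof: `[T⁰]L_p = (1 − α⁻¹)²·[0]⁺_f`
(Mazur–Swinnerton-Dyer / Mazur–Tate–Teitelbaum (14.3), tree theorem
`constantCoeff_padicLFunction_unitRoot`), `1 − α⁻¹ = u·#Ã(𝔽_p)` with `u ∈ ℤ_p^×` (tree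
`exists_unit_one_sub_unitRoot_inv`), `p ∣ #Ã(𝔽_p)` iff `p ∣ a_p − 1` (anomalous), and
`‖[0]⁺_f‖_p ≤ 1` for `p` odd under (irr) (Drinfeld–Manin `p`-integrally, tree
`Additive.norm_ratPlusSymbol_le_one_of_irreducible`). No named fact is used. (So for anomalous `ρ̄`
EVERY weight-two good-ordinary member of `H(ρ̄)` has `λ^an ≥ 1` or `μ^an ≥ 1`; Greenberg's conjecture
predicts the former.) [cite: MazurTateTeitelbaum1986Invent, §I.14 (14.3)] [cite: Mazur1972, §1 (anomalous primes)] -/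
theorem norm_coeff_zero_padicLFunction_lt_one_of_anomalous
    (A : WeierstrassCurve ℚ) [A.IsElliptic] [A.IsGloballyMinimal] (p : ℕ) [Fact p.Prime] (hp2 : p ≠ 2)
    (hgood : A.HasGoodReductionAtPrime p) (hord : ¬ (p : ℤ) ∣ A.frobeniusTrace p)
    (hirr : A.HasIrreducibleModPGaloisRep p) (hanom : (p : ℤ) ∣ A.frobeniusTrace p - 1)
    {N : ℕ} [NeZero N] (f : CuspForm (Gamma0 N) 2) (hf : IsNewformOf A f) :
    ‖PowerSeries.coeff 0 (padicLFunction f (unitRoot A p : ℚ_[p]))‖ < 1 := by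
  have hordp : IsOrdinaryAt A p := ⟨hgood, hord⟩
  -- `1 − α⁻¹ = u · #Ã(𝔽_p)` with `‖u‖ = 1` and `‖#Ã(𝔽_p)‖ < 1` (anomalous)
  obtain ⟨u, hu⟩ := exists_unit_one_sub_unitRoot_inv p A hordp
  have hun : ‖((u : ℤ_[p]) : ℚ_[p])‖ = 1 := by
    rw [PadicInt.padic_norm_e_of_padicInt]
    exact PadicInt.isUnit_iff.mp u.isUnit
  have hcnt : ‖(A.reductionPointCount p : ℚ_[p])‖ < 1 :=
    Padic.norm_natCast_lt_one_iff.mpr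
      ((dvd_reductionPointCount_iff_dvd_frobeniusTrace_sub_one A p).mpr hanom)
  have h1 : ‖(1 - ((unitRoot A p : ℤ_[p]) : ℚ_[p])⁻¹)‖ < 1 := by
    rw [hu, norm_mul, hun, one_mul]
    exact hcnt
  -- `‖[0]⁺_f‖ ≤ 1` (irreducible, `p` odd)
  have hs : ‖((ratPlusSymbol f 0 : ℚ) : ℚ_[p])‖ ≤ 1 :=
    Summit.BirchSwinnertonDyer.Rank1Residual.Additive.norm_ratPlusSymbol_le_one_of_irreducible hp2 hf
      hirr 0
  rw [PowerSeries.coeff_zero_eq_constantCoeff, constantCoeff_padicLFunction_unitRoot hordp hf,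
    norm_mul, norm_pow]
  have h0 : 0 ≤ ‖(1 - ((unitRoot A p : ℤ_[p]) : ℚ_[p])⁻¹)‖ := norm_nonneg _
  calc ‖(1 - ((unitRoot A p : ℤ_[p]) : ℚ_[p])⁻¹)‖ ^ 2 * ‖((ratPlusSymbol f 0 : ℚ) : ℚ_[p])‖
      ≤ ‖(1 - ((unitRoot A p : ℤ_[p]) : ℚ_[p])⁻¹)‖ ^ 2 * 1 :=
        mul_le_mul_of_nonneg_left hs (pow_nonneg h0 2)
    _ < 1 := by
        rw [mul_one]
        exact pow_lt_one₀ h0 h1 two_ne_zero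

/-- **On the congruence class of an anomalous X9 pair, no good-ordinary elliptic member has a unit
constant coefficient.** For an X9 pair `(W, p)` with `p ∣ a_p(W) − 1` and ANY globally minimal `A/ℚ`
good ordinary at `p` with a `Γ_ℚ`-equivariant `A[p] ≃ W[p]` (so `A[p]` is irreducible and `A` is
anomalous at `p`, §1), every newform `f` of `A` has `‖[T⁰]L_p(f, α_A)‖_p < 1`. The unit-`L`-value road
of gen 0 (`analyticCertificate_of_unitLValue`: a unit CONSTANT coefficient) therefore never reaches the
anomalous sub-class of X9, through any elliptic partner. Unconditional.
[cite: MazurTateTeitelbaum1986Invent, §I.14 (14.3)] [cite: Serre1972, §1.11 (1), Prop. 11 and Cor.] -/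
theorem norm_coeff_zero_lt_one_of_partner_of_anomalous_classX9
    (W : WeierstrassCurve ℚ) [W.IsElliptic] [W.IsGloballyMinimal] (p : ℕ) [Fact p.Prime]
    (hX9 : ClassX9 W p) (hanom : (p : ℤ) ∣ W.frobeniusTrace p - 1)
    (A : WeierstrassCurve ℚ) [A.IsElliptic] [A.IsGloballyMinimal]
    (hgoodA : A.HasGoodReductionAtPrime p) (hordA : ¬ (p : ℤ) ∣ A.frobeniusTrace p)
    (hiso : ∃ e : geomTorsion A (p : ℤ) ≃+ geomTorsion W (p : ℤ),
      ∀ (σ : Field.absoluteGaloisGroup ℚ) (P : geomTorsion A (p : ℤ)), e (σ • P) = σ • e P)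
    {N : ℕ} [NeZero N] (f : CuspForm (Gamma0 N) 2) (hf : IsNewformOf A f) :
    ‖PowerSeries.coeff 0 (padicLFunction f (unitRoot A p : ℚ_[p]))‖ < 1 := by
  have hapA : (p : ℤ) ∣ A.frobeniusTrace p - 1 :=
    (dvd_frobeniusTrace_sub_one_iff_of_partner_of_classX9 W p hX9 A hgoodA hordA hiso).mp hanom
  obtain ⟨-, hp, -, -, hirr, -⟩ := hX9
  obtain ⟨e, he⟩ := hiso
  have hirrA : A.HasIrreducibleModPGaloisRep p := hasIrreducibleModPGaloisRep_of_torsionIso_symm e he hirr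
  exact norm_coeff_zero_padicLFunction_lt_one_of_anomalous A p (by omega) hgoodA hordA hirrA hapA f hf

/-- **The self case**: an anomalous X9 pair `(W, p)` has `‖[T⁰]L_p(f, α_W)‖_p < 1` for every newform
`f` of `W` — its own unit-`L`-value certificate (`analyticMuZeroOnClassX9_at_of_unitLValue`) cannot
fire; on these pairs the crux needs a unit coefficient of POSITIVE index. Unconditional.
[cite: MazurTateTeitelbaum1986Invent, §I.14 (14.3)] -/
theorem norm_coeff_zero_lt_one_of_anomalous_classX9
    (W : WeierstrassCurve ℚ) [W.IsElliptic] [W.IsGloballyMinimal] (p : ℕ) [Fact p.Prime]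
    (hX9 : ClassX9 W p) (hanom : (p : ℤ) ∣ W.frobeniusTrace p - 1)
    {N : ℕ} [NeZero N] (f : CuspForm (Gamma0 N) 2) (hf : IsNewformOf W f) :
    ‖PowerSeries.coeff 0 (padicLFunction f (unitRoot W p : ℚ_[p]))‖ < 1 := by
  obtain ⟨-, hp, hgood, hord, hirr, -⟩ := hX9
  exact norm_coeff_zero_padicLFunction_lt_one_of_anomalous W p (by omega) hgood hord hirr hanom f hf

/-! ### §3b Nor does any CYCLOTOMIC special value: `L_p(A)(ζ − 1)` is a non-unit for every `ζ ∈ μ_{p^∞}` -/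

/-- **At an anomalous good ordinary odd prime with irreducible `A[p]`, NO cyclotomic special value of
`L_p(A, T)` is a unit.** For every newform `f` of `A`, every `m ≥ 1` and every primitive even Dirichlet
character `χ` of conductor `p^m` with values in `ℂ_p` and of `p`-power order (a character of `Γ`), the
interpolation value `L_p(f, α_A)(χ(γ) − 1) = α⁻ᵐ ∑_{a mod p^m} χ(a) [a/p^m]⁺_f`
(`= α⁻ᵐ τ(χ) L(A, χ̄, 1)/Ω⁺_f` by Birch's formula) has `‖·‖_p < 1`. Proof: the value is
`∑_k c_k (ζ − 1)^k` (tree theorem `hasSum_coeff_padicLFunction_unitRoot`, Mazur–Tate–Teitelbaum (14.3)),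
`‖c₀‖ < 1` (§3), `‖c_k‖ ≤ 1` (Greenberg–Vatsal Prop. 3.7, tree theorem
`padicLFunction_mem_integral_holds`) and `‖ζ − 1‖ < 1` for the `p`-power root of unity `ζ = χ(γ)`, so
every term — hence, `ℂ_p` being ultrametric, the sum — has norm `≤ max(‖c₀‖, ‖ζ − 1‖) < 1`. So on
the anomalous sub-class the "unit special value" repair of gen 0's display by TWISTED `L`-values at
`p`-power conductor is void as well: `μ^an = 0` there is visible only as valuations of these values
tending to `0` along the tower (Weierstrass preparation), never as a unit. Unconditional.
[cite: MazurTateTeitelbaum1986Invent, §I.14 (14.3)] [cite: GreenbergVatsal2000, Prop. 3.7]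
[cite: Mazur1972, §1 (anomalous primes)] -/
theorem norm_cyclotomicValue_padicLFunction_lt_one_of_anomalous
    (A : WeierstrassCurve ℚ) [A.IsElliptic] [A.IsGloballyMinimal] (p : ℕ) [Fact p.Prime] (hp2 : p ≠ 2)
    (hgood : A.HasGoodReductionAtPrime p) (hord : ¬ (p : ℤ) ∣ A.frobeniusTrace p)
    (hirr : A.HasIrreducibleModPGaloisRep p) (hanom : (p : ℤ) ∣ A.frobeniusTrace p - 1)
    {N : ℕ} [NeZero N] (f : CuspForm (Gamma0 N) 2) (hf : IsNewformOf A f)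
    {m : ℕ} (hm : 0 < m) (χ : DirichletCharacter ℂ_[p] (p ^ m)) (hχ : χ.IsPrimitive)
    (heven : χ.Even) (hordχ : ∃ j : ℕ, orderOf χ = p ^ j) :
    ‖algebraMap ℚ_[p] ℂ_[p] ((unitRoot A p : ℚ_[p])⁻¹ ^ m) * ratTwistedSymbolSum f χ‖ < 1 := by
  have hordp : IsOrdinaryAt A p := ⟨hgood, hord⟩
  have hsum := hasSum_coeff_padicLFunction_unitRoot hordp hf hm χ hχ heven hordχ
  rw [← hsum.tsum_eq]
  set T : ℂ_[p] := χ (cyclotomicGenerator p : ZMod (p ^ m)) - 1 with hT_def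
  -- `‖T‖ < 1`: `χ(γ)` is a `p`-power root of unity
  have hT : ‖T‖ < 1 := by
    obtain ⟨j, hj⟩ := hordχ
    obtain ⟨v, hv⟩ := isUnit_cyclotomicGenerator_cast p m
    refine norm_sub_one_lt_one_of_pow_prime_pow_eq_one (j := j) ?_
    rw [← hv, ← MulChar.pow_apply_coe, ← hj, pow_orderOf_eq_one, MulChar.one_apply_coe]
  -- `‖c₀‖ < 1` (§3) and `‖c_k‖ ≤ 1` (integrality)
  have hc0 : ‖PowerSeries.coeff 0 (padicLFunction f (unitRoot A p : ℚ_[p]))‖ < 1 :=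
    norm_coeff_zero_padicLFunction_lt_one_of_anomalous A p hp2 hgood hord hirr hanom f hf
  have hck : ∀ k : ℕ, ‖PowerSeries.coeff k (padicLFunction f (unitRoot A p : ℚ_[p]))‖ ≤ 1 := by
    intro k
    rw [coeff_padicLFunction]
    exact padicLFunction_mem_integral_holds hp2 hordp hf hirr k
  set C : ℝ := max ‖PowerSeries.coeff 0 (padicLFunction f (unitRoot A p : ℚ_[p]))‖ ‖T‖ with hC_def
  have hC1 : C < 1 := max_lt hc0 hT
  refine lt_of_le_of_lt (IsUltrametricDist.norm_tsum_le_of_forall_le fun k => ?_) hC1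
  rw [norm_mul, norm_pow, norm_algebraMap']
  rcases k with _ | k
  · rw [pow_zero, mul_one]
    exact le_max_left _ _
  · calc ‖PowerSeries.coeff (k + 1) (padicLFunction f (unitRoot A p : ℚ_[p]))‖ * ‖T‖ ^ (k + 1)
        ≤ 1 * ‖T‖ ^ (k + 1) :=
          mul_le_mul_of_nonneg_right (hck _) (pow_nonneg (norm_nonneg _) _)
      _ ≤ ‖T‖ := by
          rw [one_mul, pow_succ]
          exact mul_le_of_le_one_left (norm_nonneg _) (pow_le_one₀ (norm_nonneg _) hT.le)
      _ ≤ C := le_max_right _ _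

/-- **On the congruence class of an anomalous X9 pair, no good-ordinary elliptic member has a unit
cyclotomic special value** (the partner form of `norm_cyclotomicValue_padicLFunction_lt_one_of_anomalous`,
with irreducibility and anomalousness transported along the `Γ_ℚ`-equivariant `A[p] ≃ W[p]`, §1).
Unconditional. [cite: MazurTateTeitelbaum1986Invent, §I.14 (14.3)] [cite: Serre1972, §1.11 (1), Prop. 11 and Cor.] -/
theorem norm_cyclotomicValue_lt_one_of_partner_of_anomalous_classX9
    (W : WeierstrassCurve ℚ) [W.IsElliptic] [W.IsGloballyMinimal] (p : ℕ) [Fact p.Prime]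
    (hX9 : ClassX9 W p) (hanom : (p : ℤ) ∣ W.frobeniusTrace p - 1)
    (A : WeierstrassCurve ℚ) [A.IsElliptic] [A.IsGloballyMinimal]
    (hgoodA : A.HasGoodReductionAtPrime p) (hordA : ¬ (p : ℤ) ∣ A.frobeniusTrace p)
    (hiso : ∃ e : geomTorsion A (p : ℤ) ≃+ geomTorsion W (p : ℤ),
      ∀ (σ : Field.absoluteGaloisGroup ℚ) (P : geomTorsion A (p : ℤ)), e (σ • P) = σ • e P)
    {N : ℕ} [NeZero N] (f : CuspForm (Gamma0 N) 2) (hf : IsNewformOf A f)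
    {m : ℕ} (hm : 0 < m) (χ : DirichletCharacter ℂ_[p] (p ^ m)) (hχ : χ.IsPrimitive)
    (heven : χ.Even) (hordχ : ∃ j : ℕ, orderOf χ = p ^ j) :
    ‖algebraMap ℚ_[p] ℂ_[p] ((unitRoot A p : ℚ_[p])⁻¹ ^ m) * ratTwistedSymbolSum f χ‖ < 1 := by
  have hapA : (p : ℤ) ∣ A.frobeniusTrace p - 1 :=
    (dvd_frobeniusTrace_sub_one_iff_of_partner_of_classX9 W p hX9 A hgoodA hordA hiso).mp hanom
  obtain ⟨-, hp, -, -, hirr, -⟩ := hX9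
  obtain ⟨e, he⟩ := hiso
  have hirrA : A.HasIrreducibleModPGaloisRep p := hasIrreducibleModPGaloisRep_of_torsionIso_symm e he hirr
  exact norm_cyclotomicValue_padicLFunction_lt_one_of_anomalous A p (by omega) hgoodA hordA hirrA hapA f
    hf hm χ hχ heven hordχ

/-- **At an anomalous X9 pair a partner's unit coefficient lives in positive degree.** If a
good-ordinary `p`-congruent partner `A` of an anomalous X9 pair `(W, p)` carries a unit coefficient
`[Tⁿ]L_p(g, α_A)` (for a newform `g` of `A`) then `n ≠ 0` (§3). Unconditional. [cite: MazurTateTeitelbaum1986Invent, §I.14 (14.3)] -/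
theorem unitCoeff_index_ne_zero_of_partner_of_anomalous_classX9
    (W : WeierstrassCurve ℚ) [W.IsElliptic] [W.IsGloballyMinimal] (p : ℕ) [Fact p.Prime]
    (hX9 : ClassX9 W p) (hanom : (p : ℤ) ∣ W.frobeniusTrace p - 1)
    (A : WeierstrassCurve ℚ) [A.IsElliptic] [A.IsGloballyMinimal]
    (hgoodA : A.HasGoodReductionAtPrime p) (hordA : ¬ (p : ℤ) ∣ A.frobeniusTrace p)
    (hiso : ∃ e : geomTorsion A (p : ℤ) ≃+ geomTorsion W (p : ℤ),
      ∀ (σ : Field.absoluteGaloisGroup ℚ) (P : geomTorsion A (p : ℤ)), e (σ • P) = σ • e P)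
    {M : ℕ} [NeZero M] (g : CuspForm (Gamma0 M) 2) (hg : IsNewformOf A g)
    {n : ℕ} (hn : ‖PowerSeries.coeff n (padicLFunction g (unitRoot A p : ℚ_[p]))‖ = 1) : n ≠ 0 := by
  rintro rfl
  have h := norm_coeff_zero_lt_one_of_partner_of_anomalous_classX9 W p hX9 hanom A hgoodA hordA hiso g hg
  rw [hn] at h
  exact lt_irrefl _ h

end Summit.BirchSwinnertonDyer.BirchSwinnertonDyer.Rank1Residual

end
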